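import Summits.Ventures.HSemireg.ComponentCells
import Summits.Ventures.HSemireg.AmplificationChainG4RouteC
import HarnessLib

/-!
# Component cells, route (C): the door-agnostic seed door and its perfect-complex instance at `g = 6`

`ComponentCells.lean` reads every door of the cell through `weilClassesComponent_of_localClause_member` (reach ∧ a Weil-type
member of the cell `δ` ∧ a non-zero rational Weil class `w` ∧ the LOCAL VARIATIONAL CLAUSE at that member).  Since then the tree
acquired the door «once for all object kinds» `weilAnchorLocalClause_of_localVariationalHodgeFor_of_seedOn`
(`AmplificationChainAssembly.lean`): a door-agnostic local variational statement `LocalVariationalHodgeFor 𝒪` for an object class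
`𝒪` together with ONE seed of class `𝒪` on the anchor (`HasSeedOn 𝒪 n P h w`) gives the clause.  This file composes the two:

* `weilClassesComponent_of_localVariationalHodgeFor_of_seedOn_member` (any `(n, d, δ)`, any object class `𝒪`) and its
  `g = 6` specialisation `weilSixfoldComponent_of_localVariationalHodgeFor_of_seedOn_member`;
* **route (C)** — the perfect-complex door of seats p4/p7 (`PerfectComplexRankDoor.lean`, `AmplificationChainG4RouteC.lean`): with
  `𝒪 := rankObjClass C` (bounded complexes of vector bundles with `{1..n} ⊆ I`, `Ext^{<0} = 0`, `Hom = ℂ`, `rank Ext² ≤ r(A, ch)`)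
  and the venture's NAMED transfer assumption `PerfectComplexRankTransfer C` taken BY NAME (an assumption of the venture, of
  printed strength on paper by [BF08, Prop. 6.4.4] + the printed transfer for semiregular perfect COMPLEXES — [Pridham 2024, Cor. 2.25 /
  Rem. 2.27] + [Perry 2022, Prop. 8.1] (preprint form: Perry 2026 Thm. 1.1); [BF03, Thm. 5.1] is the SHEAF case and is NOT an input here; NOT a
  refereed Literature fact), ONE rank-admissible perfect
  complex seed on a Weil-type `(3, d)` member of the cell settles `WeilClassesComponent 3 d δ`
  (`weilSixfoldComponent_of_perfectComplexRankTransfer_of_seedOn_member`) — the TARGET-TABLE template for a route-(C) row at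
  `g = 6`.  Nothing is asserted: every hypothesis is explicit, the transfer is a hypothesis by name, the seed a hypothesis by value.

NOT here: any seed (no row of the `g = 6` table certifies one), any claim about `PerfectComplexRankTransfer`.
[cite: Deligne1982HodgeCycles, proof of Thm. 4.8] [cite: Pridham2024Semiregularity, Cor. 2.25, Rem. 2.27] [cite: Perry2022, Prop. 8.1]
[cite: BuchweitzFlenner2008HH, Prop. 6.4.4]
-/

noncomputable section

open CategoryTheory AlgebraicGeometry

namespace Summit.Ventures.HSemireg

open Literature.AlgebraicGeometry Literature.AlgebraicGeometry.Motives
open Literature.AlgebraicGeometry.HodgeTheory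
open Literature.AlgebraicGeometry.VanGeemen1994
open Literature.AlgebraicTopology.SingularHomology
open Summit.HodgeConjecture.HodgeConjecture.Ring2.Hypotheses
open Summit.HodgeConjecture.HodgeConjecture.Ring2.AbelianAll

/-! ## §1 The door-agnostic seed door, cell form -/

/-- **Seed door, any object class, cell form `(n, d, δ)`.** Granting BY NAME Deligne's reach-by-similitude
`weilFamilyReach_similar` (REFEREED) and a door-agnostic local variational statement `LocalVariationalHodgeFor 𝒪` for the object
class `𝒪` (a HYPOTHESIS — for `𝒪 = bfSheafClass C` it is BF Thm. 5.1, for `𝒪 = rankObjClass C` it is the venture's route-(C)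
assumption): a polarized Weil-type `(n, d)` member `(P, ψ₀, h_K)` of the cell `δ`, a non-zero rational Weil class `w` on it and ONE
seed of class `𝒪` on `P` with `κ_n = q·h_Kⁿ + w`, `κ_p = c_p·h_Kᵖ` (`HasSeedOn 𝒪 n P h_K w`) ⟹ `WeilClassesComponent n d δ`.
(`weilClassesComponent_of_localClause_member` fed with `weilAnchorLocalClause_of_localVariationalHodgeFor_of_seedOn`.)
[cite: Deligne1982HodgeCycles, proof of Thm. 4.8] [cite: BuchweitzFlenner2003, §5 Thm. 5.1 (the argument shape)] -/
theorem weilClassesComponent_of_localVariationalHodgeFor_of_seedOn_member {𝒪 : ObjClass} {n d : ℕ}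
    {δ : weilNormResidueGroup d} (hF : weilFamilyReach_similar) (hT : LocalVariationalHodgeFor 𝒪)
    {P : AbelianVariety ℂ} {ψ₀ : P ⟶ P} (hW : IsWeilType P ψ₀ n d) (e : ProjectiveEmbedding P.X)
    {a : complexBetti (projectiveSpace e.n ℂ) 2} (haQ : IsRationalClass a) (ha0 : a ≠ 0)
    (hδ : HasWeilDiscriminantNondeg P ψ₀ n d (symmetrisedClass d P ψ₀ e a) δ)
    {w : complexBetti P.X (2 * n)} (hwW : w ∈ weilClassesOf P ψ₀ n d) (hwQ : IsRationalClass w) (hw0 : w ≠ 0)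
    (hS : HasSeedOn 𝒪 n P (symmetrisedClass d P ψ₀ e a) w) :
    WeilClassesComponent n d δ :=
  weilClassesComponent_of_localClause_member hF hW e haQ ha0 hδ hwW hwQ hw0
    (weilAnchorLocalClause_of_localVariationalHodgeFor_of_seedOn d hT hS)

/-- **`g = 6` seed door, any object class** (`n = 3`): reach ∧ `LocalVariationalHodgeFor 𝒪` ∧ a Weil-type `(3, d)` member of the
cell with its Gram placement ∧ `w` ∧ ONE seed of class `𝒪` on it ⟹ `WeilClassesComponent 3 d δ`.
[cite: Deligne1982HodgeCycles, proof of Thm. 4.8] -/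
theorem weilSixfoldComponent_of_localVariationalHodgeFor_of_seedOn_member {𝒪 : ObjClass} {d : ℕ}
    {δ : weilNormResidueGroup d} (hF : weilFamilyReach_similar) (hT : LocalVariationalHodgeFor 𝒪)
    {P : AbelianVariety ℂ} {ψ₀ : P ⟶ P} (hW : IsWeilType P ψ₀ 3 d) (e : ProjectiveEmbedding P.X)
    {a : complexBetti (projectiveSpace e.n ℂ) 2} (haQ : IsRationalClass a) (ha0 : a ≠ 0)
    (hδ : HasWeilDiscriminantNondeg P ψ₀ 3 d (symmetrisedClass d P ψ₀ e a) δ)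
    {w : complexBetti P.X 6} (hwW : w ∈ weilClassesOf P ψ₀ 3 d) (hwQ : IsRationalClass w) (hw0 : w ≠ 0)
    (hS : HasSeedOn 𝒪 3 P (symmetrisedClass d P ψ₀ e a) w) :
    WeilClassesComponent 3 d δ :=
  weilClassesComponent_of_localVariationalHodgeFor_of_seedOn_member hF hT hW e haQ ha0 hδ hwW hwQ hw0 hS

/-! ## §2 Route (C): the perfect-complex rank door, cell form -/

/-- **Route (C), cell form `(n, d, δ)`.** Hypotheses BY NAME: `weilFamilyReach_similar` (REFEREED fact) and
`PerfectComplexRankTransfer C` (seat p4's NAMED ASSUMPTION of the venture: the local variational Hodge statement for the real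
rank class `rankObjClass C` — bounded complexes of vector bundles with `{1..n} ⊆ I`, `Ext^{<0}(E,E) = 0`, `Hom(E,E) = ℂ`,
`rank Ext²(E,E) ≤ r(A, ch E)`; of printed strength on paper by BF 2008 Prop. 6.4.4 + Pridham 2024 Cor. 2.25 / Perry 2022 Prop. 8.1 — the transfer for
semiregular perfect complexes; BF 2003 Thm. 5.1 is the sheaf case, not an input — NOT proved in the tree).
Hypotheses BY VALUE: a polarized Weil-type `(n, d)` member of the cell `δ`, a non-zero rational Weil class `w` on it, and ONE
rank-admissible perfect complex seed on it (`HasSeedOn (rankObjClass C) n P h_K w`). Conclusion: `WeilClassesComponent n d δ`.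
[cite: BuchweitzFlenner2008HH, Prop. 6.4.4] [cite: Pridham2024Semiregularity, Cor. 2.25, Rem. 2.27] [cite: Perry2022, Prop. 8.1]
[cite: Deligne1982HodgeCycles, proof of Thm. 4.8] -/
theorem weilClassesComponent_of_perfectComplexRankTransfer_of_seedOn_member (C : ChernCharacterBetti) {n d : ℕ}
    {δ : weilNormResidueGroup d} (hF : weilFamilyReach_similar) (hT : PerfectComplexRankTransfer C)
    {P : AbelianVariety ℂ} {ψ₀ : P ⟶ P} (hW : IsWeilType P ψ₀ n d) (e : ProjectiveEmbedding P.X)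
    {a : complexBetti (projectiveSpace e.n ℂ) 2} (haQ : IsRationalClass a) (ha0 : a ≠ 0)
    (hδ : HasWeilDiscriminantNondeg P ψ₀ n d (symmetrisedClass d P ψ₀ e a) δ)
    {w : complexBetti P.X (2 * n)} (hwW : w ∈ weilClassesOf P ψ₀ n d) (hwQ : IsRationalClass w) (hw0 : w ≠ 0)
    (hS : HasSeedOn (rankObjClass C) n P (symmetrisedClass d P ψ₀ e a) w) :
    WeilClassesComponent n d δ :=
  weilClassesComponent_of_localVariationalHodgeFor_of_seedOn_member hF hT.localVariationalHodgeFor hW e haQ ha0 hδ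
    hwW hwQ hw0 hS

/-- **`g = 6`, route (C) — the TARGET-TABLE template for a perfect-complex row.** Granting BY NAME `weilFamilyReach_similar`
(REFEREED) and the venture's `PerfectComplexRankTransfer C` (ASSUMPTION, seat p4): a Weil-type `(3, d)` member `(P, ψ₀, h_K)` of the
sixfold cell `δ` with its Gram placement, a non-zero rational Weil class `w ∈ W_K`, and ONE rank-admissible bounded complex of
vector bundles `E•` on `P` with `ch₃(E•) = q·h_K³ + w`, `ch_p(E•) = c_p·h_Kᵖ` (`p ∈ I ∖ {3}`, `{1,2,3} ⊆ I`), `Ext^{<0}(E•,E•) = 0`,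
`Hom(E•,E•) = ℂ`, `rank Ext²(E•,E•) ≤ r(P, ch E•)` — packaged as `HasSeedOn (rankObjClass C) 3 P h_K w` — ⟹
`WeilClassesComponent 3 d δ` (HC for the Weil classes on that component of the `g = 6` Weil locus). Nothing asserted.
[cite: BuchweitzFlenner2008HH, Prop. 6.4.4] [cite: Pridham2024Semiregularity, Cor. 2.25, Rem. 2.27] [cite: Perry2022, Prop. 8.1]
[cite: Deligne1982HodgeCycles, proof of Thm. 4.8] -/
theorem weilSixfoldComponent_of_perfectComplexRankTransfer_of_seedOn_member (C : ChernCharacterBetti) {d : ℕ}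
    {δ : weilNormResidueGroup d} (hF : weilFamilyReach_similar) (hT : PerfectComplexRankTransfer C)
    {P : AbelianVariety ℂ} {ψ₀ : P ⟶ P} (hW : IsWeilType P ψ₀ 3 d) (e : ProjectiveEmbedding P.X)
    {a : complexBetti (projectiveSpace e.n ℂ) 2} (haQ : IsRationalClass a) (ha0 : a ≠ 0)
    (hδ : HasWeilDiscriminantNondeg P ψ₀ 3 d (symmetrisedClass d P ψ₀ e a) δ)
    {w : complexBetti P.X 6} (hwW : w ∈ weilClassesOf P ψ₀ 3 d) (hwQ : IsRationalClass w) (hw0 : w ≠ 0)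
    (hS : HasSeedOn (rankObjClass C) 3 P (symmetrisedClass d P ψ₀ e a) w) :
    WeilClassesComponent 3 d δ :=
  weilClassesComponent_of_perfectComplexRankTransfer_of_seedOn_member C hF hT hW e haQ ha0 hδ hwW hwQ hw0 hS

end Summit.Ventures.HSemireg

end
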